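import Literature.AnabelianGeometry.AbsoluteAnabelian.RelativeGrothendieckConjecture
import Literature.AnabelianGeometry.AbsoluteAnabelian.SubpadicGaloisSlim
import Literature.AnabelianGeometry.AbsoluteAnabelian.SubpadicFiniteExtension
import Literature.AnabelianGeometry.AbsoluteAnabelian.SubpadicIsGeneralizedSubpadic
import Literature.AnabelianGeometry.AbsoluteAnabelian.SlimTransport
import Literature.AnabelianGeometry.AbsoluteAnabelian.SlimOfDivisibleTorsionProofs
import Literature.AnabelianGeometry.AbsoluteAnabelian.GaussOrderDVR
import Literature.AnabelianGeometry.AbsoluteAnabelian.DVRFinGenDivisibleUnitsTorsion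
import Mathlib.RingTheory.WittVector.DiscreteValuationRing
import Mathlib.RingTheory.WittVector.Complete
import HarnessLib

/-!
# [Tpcs] Lemma 4.14 — DISCHARGE: `Γ_K` is center-free (indeed slim) for generalized sub-`p`-adic `K`

S. Mochizuki, *Topics surrounding the anabelian geometry of hyperbolic curves*, MSRI Publ. 41 (2003)
[Tpcs], Lemma 4.14 p. 48 (kurims manuscript, lit key `paper:url-b6dd3c96bfbd`): "Let `K` be
generalized sub-`p`-adic. Then `Γ_K` is center-free."  Typed by abc-iut-L4-t13 as the named facts
`Tpcs.Lem_4_14` / `Tpcs.Lem_4_14_slim` of `RelativeGrothendieckConjecture.lean` (p405315, FACT row D2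
of the cell's LC1 chain: the slimness input of [AbsTopI] Ex 4.8 (i), hence of the Belyi
cuspidalization model of [AbsTopII] Cor 3.7).  The printed proof deduces it from the relative
Grothendieck Conjecture [Tpcs] Thm 4.12; THIS FILE PROVES IT by an elementary route, without any
anabelian or class-field-theoretic input:

* (A) cyclotomic additive trick (`Literature.FieldTheory.Galois.eq_self_of_forall_pow_eq`);
* (B) the Kummer/valuation engine `center_absoluteGaloisGroup_eq_bot_of_divisible_isOfFinOrder`
  (`SlimOfDivisibleTorsionProofs.lean`): it needs, for every finite `M/K`, a homomorphism
  `M^× → ℤ` not killing `p` and "infinitely divisible units of `M` are torsion";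
* (C) both inputs for finitely generated extensions `L` of `Frac W(𝔽̄_p)` — the Gauss `p`-order and
  the norm (`GaussOrderDVR.lean`), and the torsion statement (`DVRFinGenDivisibleUnitsTorsion.lean`,
  via Krull–Akizuki and a `Q`-adic valuation) — pulled back along an embedding `M ↪ L`, which exists
  because finite extensions of generalized sub-`p`-adic fields are generalized sub-`p`-adic
  (`IsGeneralizedSubpadicFor.of_finite`, t13).

The Witt-vector facts used: `W(𝔽̄_p)` is a DVR with uniformizer `p` (Mathlib), and every Witt vector
is congruent mod `p` to an element algebraic over `𝔽_p` (`constantCoeff`, `ker_constantCoeff`).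
Proof-only, no definitions. [cite: MochizukiTopics2003, Lem 4.14 p.48]
-/

noncomputable section

open scoped Classical
open Polynomial IsLocalRing

namespace Literature.AnabelianGeometry.AbsoluteAnabelian

open AbsTopIII

universe u

section Witt

variable (p : ℕ) [Fact p.Prime]

/-- `p` lies in the maximal ideal of `W(𝔽̄_p)`. [cite: MochizukiTopics2003, Def 4.11 p.44] -/
private theorem witt_p_mem_maximalIdeal :
    ((p : ℕ) : WittVector p (AlgebraicClosure (ZMod p))) ∈
      maximalIdeal (WittVector p (AlgebraicClosure (ZMod p))) :=
  (IsLocalRing.mem_maximalIdeal _).mpr (WittVector.irreducible p).not_isUnit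

/-- Every Witt vector over `𝔽̄_p` satisfies a monic integer polynomial modulo `p` (lift the minimal
polynomial over `𝔽_p` of its `0`-th component). [cite: MochizukiTopics2003, Def 4.11 p.44] -/
private theorem witt_exists_monic_aeval_mem (a : WittVector p (AlgebraicClosure (ZMod p))) :
    ∃ f : ℤ[X], f.Monic ∧ aeval a f ∈ maximalIdeal (WittVector p (AlgebraicClosure (ZMod p))) := by
  set c : AlgebraicClosure (ZMod p) := WittVector.constantCoeff a with hc
  have hcint : IsIntegral (ZMod p) c := Algebra.IsIntegral.isIntegral c
  set g : (ZMod p)[X] := minpoly (ZMod p) c with hg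
  have hgmonic : g.Monic := minpoly.monic hcint
  have hlifts : g ∈ Polynomial.lifts (Int.castRingHom (ZMod p)) :=
    Polynomial.mem_lifts_of_surjective (f := Int.castRingHom (ZMod p))
      (fun y => ZMod.intCast_surjective y) g
  obtain ⟨f, hfg, -, hfmonic⟩ := Polynomial.lifts_and_natDegree_eq_and_monic hlifts hgmonic
  refine ⟨f, hfmonic, ?_⟩
  -- `constantCoeff (aeval a f) = aeval c f = aeval c g = 0`
  have hmax : maximalIdeal (WittVector p (AlgebraicClosure (ZMod p))) =
      Ideal.span {(p : WittVector p (AlgebraicClosure (ZMod p)))} :=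
    (IsDiscreteValuationRing.irreducible_iff_uniformizer _).mp (WittVector.irreducible p)
  have hcomm : WittVector.constantCoeff (aeval a f) = aeval c f := by
    rw [hc]
    exact (Polynomial.aeval_algHom_apply (WittVector.constantCoeff.toIntAlgHom) a f).symm
  rw [hmax, ← WittVector.ker_constantCoeff, RingHom.mem_ker, hcomm]
  have h0 : aeval c g = 0 := minpoly.aeval (ZMod p) c
  rw [← hfg] at h0
  -- `aeval c (f.map castHom) = aeval c f`
  rw [Polynomial.aeval_def, Polynomial.eval₂_map,
    show (algebraMap (ZMod p) (AlgebraicClosure (ZMod p))).comp (Int.castRingHom (ZMod p)) =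
        algebraMap ℤ (AlgebraicClosure (ZMod p)) from Subsingleton.elim _ _] at h0
  exact h0

end Witt

/-- **[Tpcs] Lemma 4.14, PROVED**: the absolute Galois group of a generalized sub-`p`-adic field is
center-free.  Discharges the named fact `Tpcs.Lem_4_14` (abc-iut LC1 chain, FACT row D2)
unconditionally, by the elementary route (A)–(C) of the module docstring.
[cite: MochizukiTopics2003, Lem 4.14 p.48] -/
theorem Tpcs.lem_4_14_holds : Tpcs.Lem_4_14.{u} := by
  intro K _ p _ hK
  haveI : CharZero K := hK.charZero
  have hprime : (p : ℕ).Prime := Fact.out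
  -- notation-free abbreviations
  have hp0K : ((p : ℕ) : K) ≠ 0 := Nat.cast_ne_zero.mpr hprime.ne_zero
  -- the DVR `W(𝔽̄_p)` and its fraction field
  haveI hF₀char : CharZero (FractionRing (WittVector p (AlgebraicClosure (ZMod p)))) := by
    obtain ⟨φ₀⟩ := AbsTopIII.nonempty_padic_ringHom_fracWitt p
    exact charZero_of_injective_ringHom φ₀.injective
  refine center_absoluteGaloisGroup_eq_bot_of_divisible_isOfFinOrder ((p : ℕ) : K) hp0K ?_ ?_
  · -- (hv) a homomorphism `M^× → ℤ` not killing `p`, for every finite `M/K`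
    intro M hMfin
    haveI := hMfin
    have hM : IsGeneralizedSubpadicFor (M : Type u) p := hK.of_finite (F := M)
    obtain ⟨L, _, _, hLfg, ⟨ι⟩⟩ := hM.exists_embedding
    haveI : Algebra.EssFiniteType (FractionRing (WittVector p (AlgebraicClosure (ZMod p)))) L :=
      IntermediateField.fg_top_iff.mp hLfg
    haveI : CharZero L := charZero_of_injective_ringHom
      (algebraMap (FractionRing (WittVector p (AlgebraicClosure (ZMod p)))) L).injective
    obtain ⟨w, hw⟩ := exists_unitsHom_of_essFiniteType_of_irreducible
      (WittVector p (AlgebraicClosure (ZMod p)))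
      (FractionRing (WittVector p (AlgebraicClosure (ZMod p)))) (WittVector.irreducible p) L
    refine ⟨w.comp (Units.map (ι : M →* L)), ?_⟩
    have hpL : algebraMap (FractionRing (WittVector p (AlgebraicClosure (ZMod p)))) L
        (algebraMap (WittVector p (AlgebraicClosure (ZMod p))) _ (p : ℕ)) = (p : L) := by
      rw [map_natCast, map_natCast]
    have hpL0 : (p : L) ≠ 0 := Nat.cast_ne_zero.mpr hprime.ne_zero
    have hw' := hw (by rw [hpL]; exact hpL0)
    rw [MonoidHom.comp_apply]
    convert hw' using 2
    apply Units.ext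
    simp
  · -- (hD) infinitely divisible units of a finite `M/K` have finite order
    intro M hMfin u hu
    haveI := hMfin
    have hM : IsGeneralizedSubpadicFor (M : Type u) p := hK.of_finite (F := M)
    obtain ⟨L, _, _, hLfg, ⟨ι⟩⟩ := hM.exists_embedding
    haveI : Algebra.EssFiniteType (FractionRing (WittVector p (AlgebraicClosure (ZMod p)))) L :=
      IntermediateField.fg_top_iff.mp hLfg
    set uL : Lˣ := Units.map (ι : M →* L) u with huL
    have huLdiv : ∀ N : ℕ, 0 < N → ∃ y : Lˣ, y ^ N = uL := by
      intro N hN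
      obtain ⟨b, hb⟩ := hu N hN
      exact ⟨Units.map (ι : M →* L) b, by rw [← map_pow, hb]⟩
    have hfin : IsOfFinOrder uL :=
      isOfFinOrder_of_forall_exists_pow_eq_of_essFiniteType
        (WittVector p (AlgebraicClosure (ZMod p)))
        (FractionRing (WittVector p (AlgebraicClosure (ZMod p))))
        (witt_p_mem_maximalIdeal p) (witt_exists_monic_aeval_mem p) L uL huLdiv
    obtain ⟨m, hm, hum⟩ := hfin.exists_pow_eq_one
    refine isOfFinOrder_iff_pow_eq_one.mpr ⟨m, hm, ?_⟩
    have hinj : Function.Injective (Units.map (ι : M →* L)) := by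
      intro a b hab
      exact Units.ext (ι.injective (congrArg Units.val hab))
    apply hinj
    rw [map_pow, map_one]
    exact hum

/-- `Tpcs.Lem_4_14` — `_holds` alias of `Tpcs.lem_4_14_holds` above
(appended 2026-08-28, D-0026 bookkeeping: the proof term is the existing theorem of this file;
no statement, definition or attribute is edited; no new named fact).
[cite: MochizukiTopics2003, Lem 4.14 p.48] -/
theorem _root_.Literature.AnabelianGeometry.AbsoluteAnabelian.Tpcs.Lem_4_14_holds :
    Tpcs.Lem_4_14.{u} :=
  Tpcs.lem_4_14_holds

/-- **[Tpcs] Lemma 4.14, slim form, PROVED** (the form [AbsTopI] Ex 4.8 (i) p. 58 quotes: "the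
absolute Galois group of a generalized sub-`p`-adic field is always slim").  Discharges
`Tpcs.Lem_4_14_slim` via t13's reduction `Tpcs.lem_4_14_slim_of_lem_4_14`.
[cite: MochizukiTopics2003, Lem 4.14 p.48] -/
theorem Tpcs.lem_4_14_slim_holds : Tpcs.Lem_4_14_slim.{u} :=
  Tpcs.lem_4_14_slim_of_lem_4_14 Tpcs.lem_4_14_holds

/-- `Tpcs.Lem_4_14_slim` — `_holds` alias of `Tpcs.lem_4_14_slim_holds`
above (appended 2026-08-28, D-0026 bookkeeping: the proof term is the existing theorem of this
file; no statement, definition or attribute is edited; no new named fact).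
[cite: MochizukiTopics2003, Lem 4.14 p.48] -/
theorem _root_.Literature.AnabelianGeometry.AbsoluteAnabelian.Tpcs.Lem_4_14_slim_holds :
    Tpcs.Lem_4_14_slim.{u} :=
  Tpcs.lem_4_14_slim_holds

/-- The absolute Galois group of a generalized sub-`p`-adic field is slim — UNCONDITIONAL form of
`Tpcs.Lem_4_14_slim` for direct use. [cite: MochizukiTopics2003, Lem 4.14 p.48] -/
theorem IsGeneralizedSubpadicFor.isSlimGroup_absoluteGaloisGroup {K : Type u} [Field K] {p : ℕ}
    [Fact p.Prime] (hK : IsGeneralizedSubpadicFor K p) :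
    Literature.AlgebraicGeometry.Frobenioids.IsSlimGroup (Field.absoluteGaloisGroup K) :=
  Tpcs.lem_4_14_slim_holds K p hK

/-- LC1 glue, UNCONDITIONAL: a profinite group identified with `absoluteGaloisGrp k`, `k`
generalized sub-`p`-adic, is slim (t13's `isSlimGroup_of_iso_absoluteGaloisGrp_of_isGeneralizedSubpadicFor`
with its `Tpcs.Lem_4_14_slim` hypothesis discharged) — the "`G` slim" input of [AbsTopII] Cor 3.7's
model over generalized sub-`p`-adic bases ([AbsTopI] Ex 4.8 (i) p. 58).
[cite: MochizukiAbsTopI2012, Ex 4.8 (i) p.58] -/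
theorem isSlimGroup_of_iso_absoluteGaloisGrp_of_isGeneralizedSubpadicFor_holds
    {k : Type u} [Field k] [CharZero k] {p : ℕ} [Fact p.Prime] (hk : IsGeneralizedSubpadicFor k p)
    {Γ : ProfiniteGrp.{u}} (i : Γ ≅ absoluteGaloisGrp k) :
    Literature.AlgebraicGeometry.Frobenioids.IsSlimGroup Γ :=
  isSlimGroup_of_iso_absoluteGaloisGrp_of_isGeneralizedSubpadicFor Tpcs.lem_4_14_slim_holds hk i

end Literature.AnabelianGeometry.AbsoluteAnabelian
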